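import Summits.ValiantsHypothesis.ValiantsHypothesis.Theorems.MonotoneRestorationOrbitRestorationQPValueOrbitIff
import Summits.ValiantsHypothesis.ValiantsHypothesis.Theorems.MonotoneRestorationQP.Negative.LoadBearing
import Literature.GroupTheory.PermutationGroups.SmallIndexSubgroups
import Summits.ValiantsHypothesis.ValiantsHypothesis.Theorems.MonotoneRestorationMonotoneRestorationQPPermSupportCount
import HarnessLib

/-!
# Route MonotoneRestoration — aside `OrbitCompressionQP` (stmt-ValiantsHypothesis-18332), line
# `expression_compression`: THE SUPPORT THEOREM IN ORBIT FORM, at the quasi-polynomial scale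

The registered `stub_orbitToNarrowExpression` is refuted (`OrbitToNarrowExpression.not_stub_orbitToNarrowExpression`);
its REPAIR (matrix symmetry of `f` added) is the Dawar–Pago–Seppelt extraction "small ORBITS ⇒ small
SUPPORTS ⇒ every gate value is a labelled quantity ⇒ narrow expression" at the quasi-polynomial scale.  This
file proves its FIRST HALF — orbits to supports — for the tree's unbundled Dawar–Wilsenach circuits
(`LabelledArithCircuit`, orbit size `ORB` under ALL automorphisms, §3.3), with no `VP` hypothesis and no
hypothesis on the computed polynomial:

* `index_le_ncard_autOrbit` — the permutations admitting an extension that FIXES the gate `g` form a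
  subgroup of index `≤ |Orb(g)| ≤ ORB(C)` (orbit–stabiliser: `ρ S ↦ π_ρ g` injects the cosets into the
  automorphism orbit of `g`; `Theorems.gateSupport_index_le_card` is the size form);
* `evenSupport_of_orbitSize_lt_choose` — **support theorem, orbit form**: if `ORB(C) < C(n,k)` (`n > 8`,
  `1 ≤ k ≤ n/4`), every gate has a set `X` of `< k` indices such that every EVEN permutation fixing `X`
  pointwise extends to an automorphism fixing the gate (Dixon–Mortimer 5.2B,
  `alternating_fixing_le_of_index_lt_choose`); `evenSupport_eval` — hence fixes the gate's VALUE;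
* `evenSupport_of_qpOrbit` — **at the aside's scale**: for `n ≥ n₀(c)`, orbit size `≤ 2^{(log₂ n + c)^c}`
  gives every gate an even support of size `≤ (log₂ n + c)^c` (polylogarithmic);
* `exists_valueDerivation_fixedBy` / `evenSupportedDerivation_of_qpOrbit` — **in value currency**: the
  computed polynomial has a value derivation (`SymmetricValues.toDerivation`: gate values, powers, power
  sums and elementary symmetric values of children, binarised by Newton) EVERY value of which is fixed by
  all even permutations fixing some `≤ (log₂ n + c)^c` indices.  This is exactly the input of the missing
  SECOND half of the repaired stub (supported one-sorted values of a matrix-symmetric `f` ⇒ narrow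
  bipartite expression), which Dawar–Pago–Seppelt 2025 prove only for `Sym_n × Sym_m`-symmetric circuits
  (p. 17 Remark, p. 45) — left open here.

Helper file (`--supports stmt-ValiantsHypothesis-18332`); def-free; nothing here is a named fact.
-/

noncomputable section

open scoped Classical

-- `Summit.ValiantsHypothesis.ValiantsHypothesis.…` is the tree's single-conjunct layout (Sub = Summit).
set_option linter.dupNamespace false

namespace Summit.ValiantsHypothesis.ValiantsHypothesis.Theorems

namespace OrbitSupport

open Literature.Computability.AlgebraicComplexity Literature.GroupTheory.PermutationGroups MvPolynomial

universe u v w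

/-! ### Orbit–stabiliser for automorphism orbits -/

/-- **Index of the gate stabiliser is at most the automorphism orbit of the gate.**  In a `Γ`-symmetric
labelled circuit, the subgroup of those `γ` having an extension that fixes `g` has index
`≤ |Orb(g)|`: choosing extensions `π_γ`, the map `γ S ↦ π_γ g` is an injection of the left cosets into
`Orb(g)`. [cite: DawarWilsenach2025, §3.3] -/
theorem index_le_ncard_autOrbit {K : Type u} {X : Type v} {Y : Type*} {G : Type w} [Fintype G]
    {Γ : Type*} [Group Γ] [MulAction Γ X] [MulAction Γ Y] (C : LabelledArithCircuit K X Y G)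
    (hC : C.IsSymmetric Γ) (g : G) (S : Subgroup Γ)
    (hS : ∀ γ : Γ, γ ∈ S ↔ ∃ π : Equiv.Perm G, C.IsAutomorphismExtending γ π ∧ π g = g) :
    S.index ≤ (C.autOrbit Γ g).ncard := by
  choose π hπ using hC
  let f : Γ ⧸ S → C.autOrbit Γ g := fun q => ⟨π q.out g, q.out, π q.out, hπ q.out, rfl⟩
  have hf : Function.Injective f := by
    intro a b hab
    have hab' : π a.out g = π b.out g := congrArg Subtype.val hab
    rw [← QuotientGroup.out_eq' a, ← QuotientGroup.out_eq' b, QuotientGroup.eq, hS]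
    refine ⟨(π a.out)⁻¹ * π b.out, (hπ b.out).trans (hπ a.out).inv, ?_⟩
    rw [Equiv.Perm.mul_apply, ← hab', Equiv.Perm.inv_eq_iff_eq]
  rw [← Nat.card_coe_set_eq]
  exact Nat.card_le_card_of_injective f hf

/-! ### The support theorem in orbit form -/

/-- **SUPPORT THEOREM, ORBIT FORM.**  In a `Sym_n`-symmetric labelled circuit on the `n × n` variable
matrix (any output indexing) of orbit size `ORB(C) < C(n,k)` (`n > 8`, `1 ≤ k`, `4k ≤ n`), every gate `g`
has a set `X` of fewer than `k` indices such that every EVEN permutation fixing `X` pointwise extends to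
an automorphism fixing `g`.  (Size form: `Theorems.stub_gateSupport`; here `|Sym_n : Stab(g)| ≤ |Orb(g)| ≤
ORB(C)` replaces `≤ |G|`.) [cite: DawarWilsenach2025, §6 (support theorem); DixonMortimer1996, Thm 5.2B] -/
theorem evenSupport_of_orbitSize_lt_choose {n : ℕ} {K : Type u} {Y : Type*} {G : Type w} [Fintype G]
    [MulAction (Equiv.Perm (Fin n)) Y] (C : LabelledArithCircuit K (Fin n × Fin n) Y G)
    (hC : C.IsSymmetric (Equiv.Perm (Fin n))) {k : ℕ} (hn : 8 < n) (hk : 1 ≤ k) (h4k : 4 * k ≤ n)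
    (horb : C.orbitSize (Equiv.Perm (Fin n)) < n.choose k) (g : G) :
    ∃ X : Finset (Fin n), X.card < k ∧ ∀ ρ : Equiv.Perm (Fin n), (∀ x ∈ X, ρ x = x) →
      Equiv.Perm.sign ρ = 1 → ∃ π : Equiv.Perm G, C.IsAutomorphismExtending ρ π ∧ π g = g := by
  let S : Subgroup (Equiv.Perm (Fin n)) :=
    { carrier := {ρ | ∃ π : Equiv.Perm G, C.IsAutomorphismExtending ρ π ∧ π g = g}
      mul_mem' := by
        rintro a b ⟨πa, ha, hag⟩ ⟨πb, hb, hbg⟩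
        exact ⟨πa * πb, hb.trans ha, by rw [Equiv.Perm.mul_apply, hbg, hag]⟩
      one_mem' := ⟨1, C.isAutomorphismExtending_one, rfl⟩
      inv_mem' := by
        rintro a ⟨πa, ha, hag⟩
        exact ⟨πa⁻¹, ha.inv, by rw [Equiv.Perm.inv_eq_iff_eq, hag]⟩ }
  have hS : ∀ ρ : Equiv.Perm (Fin n),
      ρ ∈ S ↔ ∃ π : Equiv.Perm G, C.IsAutomorphismExtending ρ π ∧ π g = g := fun ρ => Iff.rfl
  have hidx : S.index < (Fintype.card (Fin n)).choose k := by
    rw [Fintype.card_fin]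
    exact ((index_le_ncard_autOrbit C hC g S hS).trans (C.ncard_autOrbit_le_orbitSize _ g)).trans_lt
      horb
  obtain ⟨X, hXk, hX⟩ := alternating_fixing_le_of_index_lt_choose S k
    (by rwa [Fintype.card_fin]) hk (by rwa [Fintype.card_fin]) hidx
  exact ⟨X, hXk, fun ρ hρ hsign => (hS ρ).1 (hX ρ hρ hsign)⟩

/-- **Gate VALUES have even supports**: under the same hypotheses the polynomial computed at every gate
is fixed by every even permutation fixing its support pointwise (diagonal action on `x_ij`).
[cite: DawarWilsenach2025, §6] -/
theorem evenSupport_eval {n : ℕ} {K : Type u} [CommSemiring K] {Y : Type*} {G : Type w} [Fintype G]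
    [MulAction (Equiv.Perm (Fin n)) Y] (C : LabelledArithCircuit K (Fin n × Fin n) Y G)
    (hC : C.IsSymmetric (Equiv.Perm (Fin n))) {k : ℕ} (hn : 8 < n) (hk : 1 ≤ k) (h4k : 4 * k ≤ n)
    (horb : C.orbitSize (Equiv.Perm (Fin n)) < n.choose k) (g : G) :
    ∃ X : Finset (Fin n), X.card < k ∧ ∀ ρ : Equiv.Perm (Fin n), (∀ x ∈ X, ρ x = x) →
      Equiv.Perm.sign ρ = 1 →
        MvPolynomial.rename (fun x : Fin n × Fin n => ρ • x) (C.eval g) = C.eval g := by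
  obtain ⟨X, hXk, hX⟩ := evenSupport_of_orbitSize_lt_choose C hC hn hk h4k horb g
  refine ⟨X, hXk, fun ρ hρ hsign => ?_⟩
  obtain ⟨π, hπ, hπg⟩ := hX ρ hρ hsign
  rw [← hπ.eval_apply g, hπg]

/-! ### The quasi-polynomial scale -/

/-- **The threshold**: for every `c` there is `n₀` such that for `n ≥ n₀`, with `E = (log₂ n + c)^c`,
`8 < n`, `4 (E + 1) ≤ n` and `2^E < C(n, E+1)` (`2^s ≤ C(k,s)` for `2s ≤ k`,
`Theorems.permSupportCount_two_pow_le_choose`). [folklore] -/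
theorem threshold (c : ℕ) : ∃ n₀ : ℕ, ∀ n : ℕ, n₀ ≤ n →
    8 < n ∧ 4 * ((Nat.log 2 n + c) ^ c + 1) ≤ n ∧
      2 ^ ((Nat.log 2 n + c) ^ c) < n.choose ((Nat.log 2 n + c) ^ c + 1) := by
  obtain ⟨n₀, hn₀⟩ := MonotoneRestorationQP.Negative.polylog_pow_lt_linear c (δ := 1 / 8) (by norm_num)
  refine ⟨max n₀ 9, fun n hn => ?_⟩
  set E : ℕ := (Nat.log 2 n + c) ^ c with hE
  have hE1 : 1 ≤ E := by
    rcases Nat.eq_zero_or_pos c with rfl | hc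
    · simp [hE]
    · exact Nat.one_le_pow _ _ (by omega)
  have h8E : 8 * E < n := by
    have hreal := hn₀ n (le_of_max_le_left hn)
    have : ((8 * E : ℕ) : ℝ) < (n : ℝ) := by push_cast [hE]; linarith
    exact_mod_cast this
  have h9 : 9 ≤ n := le_of_max_le_right hn
  refine ⟨by omega, by omega, ?_⟩
  calc 2 ^ E < 2 ^ (E + 1) := Nat.pow_lt_pow_right Nat.one_lt_two (Nat.lt_succ_self E)
    _ ≤ n.choose (E + 1) := permSupportCount_two_pow_le_choose (E + 1) n (by omega)

/-- **EVEN SUPPORTS AT THE QUASI-POLYNOMIAL SCALE.**  For every `c` there is `n₀` such that, for `n ≥ n₀`,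
in every `Sym_n`-symmetric labelled circuit on the `n × n` matrix of orbit size `≤ 2^{(log₂ n + c)^c}`
every gate has a set `X` of at most `(log₂ n + c)^c` indices such that every even permutation fixing `X`
pointwise extends to an automorphism fixing the gate, and in particular fixes its value.
[cite: DawarWilsenach2025, §6; DawarPagoSeppelt2025, Theorem 1.1] -/
theorem evenSupport_of_qpOrbit (c : ℕ) : ∃ n₀ : ℕ, ∀ n : ℕ, n₀ ≤ n →
    ∀ {K : Type u} [CommSemiring K] {Y : Type} [MulAction (Equiv.Perm (Fin n)) Y] {G : Type w}
      [Fintype G] (C : LabelledArithCircuit K (Fin n × Fin n) Y G),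
      C.IsSymmetric (Equiv.Perm (Fin n)) →
      C.orbitSize (Equiv.Perm (Fin n)) ≤ 2 ^ ((Nat.log 2 n + c) ^ c) →
      ∀ g : G, ∃ X : Finset (Fin n), X.card ≤ (Nat.log 2 n + c) ^ c ∧
        ∀ ρ : Equiv.Perm (Fin n), (∀ x ∈ X, ρ x = x) → Equiv.Perm.sign ρ = 1 →
          (∃ π : Equiv.Perm G, C.IsAutomorphismExtending ρ π ∧ π g = g) ∧
          MvPolynomial.rename (fun x : Fin n × Fin n => ρ • x) (C.eval g) = C.eval g := by
  obtain ⟨n₀, hn₀⟩ := threshold c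
  refine ⟨n₀, fun n hn K _ Y _ G _ C hC horb g => ?_⟩
  obtain ⟨h8, h4, hch⟩ := hn₀ n hn
  obtain ⟨X, hXk, hX⟩ := evenSupport_of_orbitSize_lt_choose C hC h8 (Nat.succ_pos _) h4
    (horb.trans_lt hch) g
  refine ⟨X, Nat.lt_succ_iff.1 hXk, fun ρ hρ hsign => ⟨hX ρ hρ hsign, ?_⟩⟩
  obtain ⟨π, hπ, hπg⟩ := hX ρ hρ hsign
  rw [← hπ.eval_apply g, hπg]

/-! ### In value currency -/

/-- **The values of the circuit's value derivation are gate-indexed invariants.**  Every value of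
`SymmetricValues.toDerivation C` (gate values, powers of gate values, power sums / Newton products /
elementary symmetric values of the children of a gate) is attached to a gate `g` so that every
automorphism over `γ` fixing `g` fixes the value under `γ`. [folklore] -/
theorem exists_valueDerivation_fixedBy {K : Type u} {X : Type v} {G : Type w} [Field K] [CharZero K]
    [Fintype G] (C : LabelledArithCircuit K X Unit G) {Γ : Type*} [Group Γ] [MulAction Γ X] :
    ∃ 𝒟 : ValueDerivation K X, C.eval (C.output ()) ∈ 𝒟.S ∧
      ∀ q ∈ 𝒟.S, ∃ g : G, ∀ (γ : Γ) (π : Equiv.Perm G),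
        C.IsAutomorphismExtending γ π → π g = g → ren γ q = q := by
  refine ⟨SymmetricValues.toDerivation C,
    Finset.mem_image.2 ⟨SymmetricValues.Nm.gate _, SymmetricValues.gate_mem_names C _, rfl⟩,
    fun q hq => ?_⟩
  obtain ⟨ν, -, rfl⟩ := Finset.mem_image.1 hq
  cases ν with
  | gate g =>
    refine ⟨g, fun γ π hπ hg => ?_⟩
    change ren γ (C.eval g) = C.eval g
    rw [SymmetricValues.ren_eval hπ, hg]
  | pw h j =>
    refine ⟨h, fun γ π hπ hg => ?_⟩
    change ren γ (C.eval h ^ j) = C.eval h ^ j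
    rw [map_pow, SymmetricValues.ren_eval hπ, hg]
  | ps g j =>
    refine ⟨g, fun γ π hπ hg => ?_⟩
    change ren γ (SymmetricValues.chP C g j) = SymmetricValues.chP C g j
    rw [SymmetricValues.ren_chP hπ, hg]
  | nt g a =>
    refine ⟨g, fun γ π hπ hg => ?_⟩
    change ren γ (SymmetricValues.chE C g a.1 * SymmetricValues.chP C g a.2) =
      SymmetricValues.chE C g a.1 * SymmetricValues.chP C g a.2
    rw [map_mul, SymmetricValues.ren_chE hπ, SymmetricValues.ren_chP hπ, hg]
  | es g k =>
    refine ⟨g, fun γ π hπ hg => ?_⟩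
    change ren γ (SymmetricValues.chE C g k) = SymmetricValues.chE C g k
    rw [SymmetricValues.ren_chE hπ, hg]

/-- **EVEN-SUPPORTED VALUE DERIVATIONS FROM QUASI-POLYNOMIAL ORBITS** — the first half of the repaired
`stub_orbitToNarrowExpression`, in value currency.  For every `c` there is `n₀` such that for `n ≥ n₀`
every polynomial over a field of characteristic `0` computed by a `Sym_n`-symmetric circuit on the
`n × n` matrix of orbit size `≤ 2^{(log₂ n + c)^c}` has a value derivation (weighted sums of any fan-in,
binary products; ANY length) every value of which is fixed by all EVEN permutations fixing pointwise some
set of at most `(log₂ n + c)^c` indices.  (The remaining half of the repaired stub — such a derivation of a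
MATRIX-symmetric `f` ⇒ `f` is the closed polynomial of a narrow bipartite pattern expression — is the
one-sorted extraction Dawar–Pago–Seppelt 2025 leave open, p. 17 / p. 45.)
[cite: DawarWilsenach2025, §6; DawarPagoSeppelt2025, §4] -/
theorem evenSupportedDerivation_of_qpOrbit (c : ℕ) : ∃ n₀ : ℕ, ∀ n : ℕ, n₀ ≤ n →
    ∀ {K : Type u} [Field K] [CharZero K] {G : Type w} [Fintype G]
      (C : LabelledArithCircuit K (Fin n × Fin n) Unit G),
      C.IsSymmetric (Equiv.Perm (Fin n)) →
      C.orbitSize (Equiv.Perm (Fin n)) ≤ 2 ^ ((Nat.log 2 n + c) ^ c) →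
      ∃ 𝒟 : ValueDerivation K (Fin n × Fin n), C.eval (C.output ()) ∈ 𝒟.S ∧
        ∀ q ∈ 𝒟.S, ∃ X : Finset (Fin n), X.card ≤ (Nat.log 2 n + c) ^ c ∧
          ∀ ρ : Equiv.Perm (Fin n), (∀ x ∈ X, ρ x = x) → Equiv.Perm.sign ρ = 1 → ren ρ q = q := by
  obtain ⟨n₀, hn₀⟩ := evenSupport_of_qpOrbit.{u, w} c
  refine ⟨n₀, fun n hn K _ _ G _ C hC horb => ?_⟩
  obtain ⟨𝒟, hout, hfix⟩ := exists_valueDerivation_fixedBy C (Γ := Equiv.Perm (Fin n))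
  refine ⟨𝒟, hout, fun q hq => ?_⟩
  obtain ⟨g, hg⟩ := hfix q hq
  obtain ⟨X, hXk, hX⟩ := hn₀ n hn C hC horb g
  refine ⟨X, hXk, fun ρ hρ hsign => ?_⟩
  obtain ⟨⟨π, hπ, hπg⟩, -⟩ := hX ρ hρ hsign
  exact hg ρ π hπ hπg

end OrbitSupport

end Summit.ValiantsHypothesis.ValiantsHypothesis.Theorems

end
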